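import Summits.NavierStokesRegularity.NavierStokesRegularity.Theorems.ExtremiserTransienceMultiscaleCrowdingDefs
import Summits.NavierStokesRegularity.NavierStokesRegularity.Theorems.ExtremiserTransienceNearExtremalTransiencePerFlowStubDissipationBudget
import Summits.NavierStokesRegularity.NavierStokesRegularity.Theorems.ExtremiserTransienceNearExtremalTransiencePerFlowStubViolatorDissipation
import HarnessLib

/-!
# LINE g10-γ «multiscale crowding» (crux 26567): L3ᵐˢ, the multiscale ledger count — PORT of the author's in-file proof

Helper file for the crux `NearExtremalTransiencePerFlow` (stmt-NavierStokesRegularity-26567), LINE g10-γ `multiscale_crowding` (skeleton of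
record 1c5b3d804149, planner ns-idea-5 g10).  `multiscaleLedgerCount_holds : MultiscaleLedgerCount` — the elementary multiscale packing lemma
L3ᵐˢ, PROVED in the crux workfile by the author and ported here VERBATIM (statement over the texts of record
`…MultiscaleCrowding.MultiscaleLedgerCount`; `E3` spelled out) so that it is an importable tree theorem.  Port by prover seat ns-net-p2 (g10);
proof: planner ns-idea-5 g10.

HONEST FRAMING: a packing lemma about a measure on `ℝ × ℝ³`; nothing about Navier–Stokes regularity or blow-up is proved; no summit is
proved by a line. [folklore]
-/

noncomputable section

open scoped Topology InnerProductSpace RealInnerProductSpace ENNReal ContDiff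
open MeasureTheory Filter Set Metric Function
open Literature.Analysis Literature.Analysis.FluidPDE
open Summit.NavierStokesRegularity.NavierStokesRegularity.Theses.ExtremiserTransience
open Summit.NavierStokesRegularity.NavierStokesRegularity.Theorems
open Summit.NavierStokesRegularity.NavierStokesRegularity.Theorems.NearExtremalTransiencePerFlow
open Summit.NavierStokesRegularity.NavierStokesRegularity.Theorems.NearExtremalTransiencePerFlow.ZoneTransversality
open Summit.NavierStokesRegularity.NavierStokesRegularity.Theorems.NearExtremalTransiencePerFlow.MemberSelection
open Summit.NavierStokesRegularity.NavierStokesRegularity.Theorems.NearExtremalTransiencePerFlow.DissipationLedger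
  (HasLinGrowthAllTime dissMeasure ViolatorDissipation stub_uniformDissipationBudget stub_violatorDissipation)
open Summit.NavierStokesRegularity.NavierStokesRegularity.Theorems.NearExtremalTransiencePerFlow.TightOrChain
  (UniformDissipationBudget ChainUpTo ChainsOfEveryLength)

namespace Summit.NavierStokesRegularity.NavierStokesRegularity.Theorems

set_option linter.dupNamespace false

namespace NearExtremalTransiencePerFlow.MultiscaleCrowding

set_option maxHeartbeats 400000 in
/-- **L3ᵐˢ is a THEOREM** (elementary multiscale packing, kernel-checked; no `sorry`). -/
theorem multiscaleLedgerCount_holds : MultiscaleLedgerCount := by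
  intro s ρ c D a E C hs hρ hc hD ha ha1 hC
  -- ### scales: `L0 = √(-s)`, epoch lengths `Lk k = 6^k L0`, epoch times `τ k = 36^k s`, separation factor `κ₀ = 2ρ+2D+2`
  obtain ⟨L0, hL0⟩ : ∃ L0 : ℝ, L0 = Real.sqrt (-s) := ⟨_, rfl⟩
  have hL0pos : 0 < L0 := by rw [hL0]; exact Real.sqrt_pos.2 (neg_pos.2 hs)
  have hL0sq : L0 ^ 2 = -s := by rw [hL0]; exact Real.sq_sqrt (neg_pos.2 hs).le
  obtain ⟨Lk, hL⟩ : ∃ Lk : ℕ → ℝ, ∀ k, Lk k = 6 ^ k * L0 := ⟨_, fun _ => rfl⟩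
  obtain ⟨τ, hτ⟩ : ∃ τ : ℕ → ℝ, ∀ k, τ k = 36 ^ k * s := ⟨_, fun _ => rfl⟩
  have hLpos : ∀ k, 0 < Lk k := fun k => by rw [hL]; positivity
  have hτneg : ∀ k, τ k < 0 := fun k => by rw [hτ]; exact mul_neg_of_pos_of_neg (by positivity) hs
  have h36 : ∀ k : ℕ, (36 : ℝ) ^ k = (6 ^ k) ^ 2 := fun k => by
    rw [← pow_mul, mul_comm, pow_mul]; norm_num
  have hsqrtτ : ∀ k, Real.sqrt (-(τ k)) = Lk k := by
    intro k
    rw [hτ, hL, hL0, show -(36 ^ k * s) = ((6 : ℝ) ^ k) ^ 2 * (-s) by rw [h36]; ring,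
      Real.sqrt_mul (sq_nonneg _), Real.sqrt_sq (by positivity)]
  have hLsq : ∀ k, Lk k ^ 2 = -(τ k) := fun k => by
    rw [hL, hτ, mul_pow, ← h36, hL0sq]; ring
  have hLmono : ∀ {k k' : ℕ}, k ≤ k' → Lk k ≤ Lk k' := by
    intro k k' hkk'
    rw [hL, hL]
    exact mul_le_mul_of_nonneg_right (pow_le_pow_right₀ (by norm_num) hkk') hL0pos.le
  have hτmono : ∀ {k k' : ℕ}, k ≤ k' → τ k' ≤ τ k := by
    intro k k' hkk'
    rw [hτ, hτ]
    exact mul_le_mul_of_nonpos_right (pow_le_pow_right₀ (by norm_num) hkk') hs.le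
  have hτles : ∀ k, τ k ≤ s := fun k => by
    rw [hτ]; exact mul_le_of_one_le_left hs.le (one_le_pow₀ (by norm_num))
  obtain ⟨κ₀, hκ₀⟩ : ∃ κ₀ : ℝ, κ₀ = 2 * ρ + 2 * D + 2 := ⟨_, rfl⟩
  have hκ₀pos : 0 < κ₀ := by rw [hκ₀]; positivity
  have hκ₀two : 2 ≤ κ₀ := by rw [hκ₀]; linarith
  -- the scale `ℓ₀ 6^{k}` of the statement is `κ₀ · Lk k`
  have hscale : ∀ k : ℕ, (2 * ρ + 2 * D + 2) * Real.sqrt (-s) * 6 ^ k = κ₀ * Lk k := by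
    intro k; rw [hκ₀, hL, hL0]; ring
  -- ### the number of scales `m`, chosen BEFORE `μ, P, x₀, L, k`
  obtain ⟨E', hE'0, hEE'⟩ : ∃ E' : ℝ, 0 ≤ E' ∧ E ≤ E' := ⟨max E 0, le_max_right _ _, le_max_left _ _⟩
  obtain ⟨m₀, hm₀⟩ : ∃ m₀ : ℕ, E' * (ρ + D + 2) * κ₀ / (C * c) ≤ (m₀ : ℝ) := ⟨_, Nat.le_ceil _⟩
  refine ⟨m₀ + 1, ?_⟩
  intro μ P x₀ L k hk hkL hconf hPer hSp hBud
  have hm1 : 0 < m₀ + 1 := Nat.succ_pos _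
  -- the radius is positive and dominates every used epoch length
  have hLkle : ∀ j, j < m₀ + 1 → κ₀ * Lk (k j) ≤ L := fun j hj => by rw [← hscale]; exact hkL j hj
  have hLkle' : ∀ j, j < m₀ + 1 → Lk (k j) ≤ L := fun j hj => by
    have h1 := hLkle j hj
    nlinarith [hLpos (k j), hκ₀two]
  have hLpos' : 0 < L := lt_of_lt_of_le (mul_pos hκ₀pos (hLpos (k 0))) (hLkle 0 hm1)
  -- ### iterated backward propagation with parabolic drift `≤ ρ Lk k`
  have hiter : ∀ (n : ℕ) (z : (EuclideanSpace ℝ (Fin 3))), P s z → ∃ x : (EuclideanSpace ℝ (Fin 3)), ‖x - z‖ ≤ ρ * Lk n ∧ P (τ n) x := by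
    intro n
    induction n with
    | zero =>
      intro z hz
      refine ⟨z, ?_, ?_⟩
      · rw [sub_self, norm_zero]; exact (mul_pos hρ (hLpos 0)).le
      · rw [hτ]; simpa using hz
    | succ n ih =>
      intro z hz
      obtain ⟨x, hxz, hPx⟩ := ih z hz
      obtain ⟨x', hx'x, hPx'⟩ := hPer (τ n) x (hτneg n) hPx
      refine ⟨x', ?_, ?_⟩
      · rw [hsqrtτ n] at hx'x
        have h6 : Lk (n + 1) = 6 * Lk n := by rw [hL, hL, pow_succ]; ring
        calc ‖x' - z‖ ≤ ‖x' - x‖ + ‖x - z‖ := norm_sub_le_norm_sub_add_norm_sub _ _ _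
          _ ≤ ρ * Lk n + ρ * Lk n := add_le_add hx'x hxz
          _ ≤ ρ * Lk (n + 1) := by rw [h6]; nlinarith [hLpos n, hρ]
      · have e : 36 * τ n = τ (n + 1) := by rw [hτ, hτ, pow_succ]; ring
        rw [← e]; exact hPx'
  -- ### the crowded finite sets (guarded by `j < m₀+1`) and their propagated level points
  have hS : ∀ j : ℕ, ∃ S : Finset (EuclideanSpace ℝ (Fin 3)), j < m₀ + 1 →
      (C * L / (κ₀ * Lk (k j)) ≤ (S.card : ℝ) ∧ (∀ z ∈ S, ‖z - x₀‖ ≤ L ∧ P s z) ∧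
        (∀ z ∈ S, ∀ z' ∈ S, z ≠ z' → κ₀ * Lk (k j) ≤ ‖z - z'‖)) := by
    intro j
    by_cases hj : j < m₀ + 1
    · obtain ⟨S, h1, h2, h3⟩ := hconf j hj
      refine ⟨S, fun _ => ⟨?_, h2, fun z hz z' hz' hzz => ?_⟩⟩
      · rw [← hscale]; exact h1
      · rw [← hscale]; exact h3 z hz z' hz' hzz
    · exact ⟨∅, fun h' => absurd h' hj⟩
  choose S hS using hS
  have hx : ∀ (j : ℕ) (z : (EuclideanSpace ℝ (Fin 3))), ∃ x : (EuclideanSpace ℝ (Fin 3)), j < m₀ + 1 → z ∈ S j → ‖x - z‖ ≤ ρ * Lk (k j) ∧ P (τ (k j)) x := by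
    intro j z
    by_cases h : j < m₀ + 1 ∧ z ∈ S j
    · obtain ⟨x, h1, h2⟩ := hiter (k j) z ((hS j h.1).2.1 z h.2).2
      exact ⟨x, fun _ _ => ⟨h1, h2⟩⟩
    · exact ⟨x₀, fun h1 h2 => absurd ⟨h1, h2⟩ h⟩
  choose x hx using hx
  -- ### the boxes
  obtain ⟨B, hB⟩ : ∃ B : ℕ → (EuclideanSpace ℝ (Fin 3)) → Set (ℝ × (EuclideanSpace ℝ (Fin 3))),
      ∀ j z, B j z = Set.Icc ((1 + a) * τ (k j)) (τ (k j)) ×ˢ Metric.ball (x j z) (D * Lk (k j)) := ⟨_, fun _ _ => rfl⟩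
  have hBmeas : ∀ j z, MeasurableSet (B j z) := fun j z => by
    rw [hB]; exact measurableSet_Icc.prod measurableSet_ball
  have hBspend : ∀ j z, j < m₀ + 1 → z ∈ S j → ENNReal.ofReal (c * Lk (k j)) ≤ μ (B j z) := by
    intro j z hj hz
    have h := hSp (τ (k j)) (x j z) (hτneg (k j)) (hx j z hj hz).2
    rw [hsqrtτ (k j)] at h
    rw [hB]; exact h
  -- separation within a scale
  have hsep : ∀ j z z', j < m₀ + 1 → z ∈ S j → z' ∈ S j → z ≠ z' →
      Disjoint (Metric.ball (x j z) (D * Lk (k j))) (Metric.ball (x j z') (D * Lk (k j))) := by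
    intro j z z' hj hz hz' hzz
    apply Metric.ball_disjoint_ball
    have h1 := (hS j hj).2.2 z hz z' hz' hzz
    have hxx : ‖z - z'‖ ≤ ‖x j z - x j z'‖ + ρ * Lk (k j) + ρ * Lk (k j) := by
      have e : z - z' = (x j z - x j z') - (x j z - z) + (x j z' - z') := by abel
      rw [e]
      calc ‖(x j z - x j z') - (x j z - z) + (x j z' - z')‖
          ≤ ‖(x j z - x j z') - (x j z - z)‖ + ‖x j z' - z'‖ := norm_add_le _ _
        _ ≤ ‖x j z - x j z'‖ + ‖x j z - z‖ + ‖x j z' - z'‖ := by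
            gcongr; exact norm_sub_le _ _
        _ ≤ _ := by linarith [(hx j z hj hz).1, (hx j z' hj hz').1]
    rw [dist_eq_norm]
    have e := hκ₀
    nlinarith [hLpos (k j), hD]
  -- separation of the time intervals across epochs
  have htime : ∀ n n' : ℕ, n < n' → Disjoint (Set.Icc ((1 + a) * τ n) (τ n)) (Set.Icc ((1 + a) * τ n') (τ n')) := by
    intro n n' hnn'
    rw [Set.disjoint_left]
    intro p hp hp'
    have h1 : τ n' ≤ 36 * τ n := by
      have e : 36 * τ n = τ (n + 1) := by rw [hτ, hτ, pow_succ]; ring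
      rw [e]; exact hτmono (Nat.succ_le_of_lt hnn')
    have h2 : 36 * τ n < (1 + a) * τ n := by nlinarith [hτneg n]
    linarith [hp.1, hp'.2, h1, h2]
  -- ### the index set: scales `j < m₀+1`, points `z ∈ S j`
  obtain ⟨I, hI⟩ : ∃ I : Finset ((_ : ℕ) × (EuclideanSpace ℝ (Fin 3))), I = (Finset.range (m₀ + 1)).sigma fun j => S j := ⟨_, rfl⟩
  have hmemI : ∀ p ∈ I, p.1 < m₀ + 1 ∧ p.2 ∈ S p.1 := by
    intro p hp
    rw [hI, Finset.mem_sigma, Finset.mem_range] at hp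
    exact hp
  have hpd : Set.PairwiseDisjoint (↑I : Set ((_ : ℕ) × (EuclideanSpace ℝ (Fin 3)))) (fun p => B p.1 p.2) := by
    intro p hp q hq hpq
    have hp' := hmemI p (Finset.mem_coe.1 hp)
    have hq' := hmemI q (Finset.mem_coe.1 hq)
    obtain ⟨j, z⟩ := p
    obtain ⟨j', z'⟩ := q
    show Disjoint (B j z) (B j' z')
    rw [hB, hB, Set.disjoint_prod]
    rcases lt_trichotomy (k j) (k j') with hlt | heq | hgt
    · exact Or.inl (htime _ _ hlt)
    · have hjj : j = j' := hk.injective heq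
      subst hjj
      right
      have hzz : z ≠ z' := by
        intro h; subst h; exact hpq rfl
      exact hsep j z z' hp'.1 hp'.2 hq'.2 hzz
    · exact Or.inl (htime _ _ hgt).symm
  -- ### every box lies in the big cylinder `[(1+a) τ (k m₀), s] × B(x₀, R)`, `R = (ρ+D+2) L`
  obtain ⟨R, hR⟩ : ∃ R : ℝ, R = (ρ + D + 2) * L := ⟨_, rfl⟩
  have hRL : L ≤ R := by rw [hR]; nlinarith [hLpos', hρ, hD]
  have hRpos : 0 < R := hLpos'.trans_le hRL
  have hkmono : ∀ j, j < m₀ + 1 → k j ≤ k m₀ := fun j hj => hk.monotone (Nat.le_of_lt_succ hj)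
  have hBsub : ∀ p ∈ I, B p.1 p.2 ⊆ Set.Icc ((1 + a) * τ (k m₀)) s ×ˢ Metric.ball x₀ R := by
    intro p hp
    obtain ⟨hj, hz⟩ := hmemI p hp
    rw [hB]
    refine Set.prod_mono (Set.Icc_subset_Icc ?_ (hτles _)) ?_
    · exact mul_le_mul_of_nonneg_left (hτmono (hkmono p.1 hj)) (by linarith)
    · apply Metric.ball_subset_ball'
      rw [dist_eq_norm]
      have hxle : ‖x p.1 p.2 - x₀‖ ≤ ‖x p.1 p.2 - p.2‖ + ‖p.2 - x₀‖ := norm_sub_le_norm_sub_add_norm_sub _ _ _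
      have h1 := (hx p.1 p.2 hj hz).1
      have h2 := ((hS p.1 hj).2.1 p.2 hz).1
      have h3 := hLkle' p.1 hj
      rw [hR]
      nlinarith [hD, hρ, hLpos (k p.1)]
  -- ### the ledger inequality in `ℝ≥0∞`, then in `ℝ`
  have hτ1s : (1 + a) * τ (k m₀) < s := by
    have h1 : (1 + a) * τ (k m₀) < τ (k m₀) := by nlinarith [hτneg (k m₀)]
    exact h1.trans_le (hτles _)
  have hτR : -((1 + a) * τ (k m₀)) ≤ R ^ 2 := by
    have h1 : -((1 + a) * τ (k m₀)) = (1 + a) * Lk (k m₀) ^ 2 := by rw [hLsq]; ring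
    have h2 : 2 * Lk (k m₀) ≤ R := by
      have h3 := hLkle m₀ (Nat.lt_succ_self _)
      nlinarith [hLpos (k m₀), hκ₀two, hRL]
    have h3 : (2 * Lk (k m₀)) ^ 2 ≤ R ^ 2 := pow_le_pow_left₀ (by linarith [hLpos (k m₀)]) h2 2
    have h4 : (1 + a) * Lk (k m₀) ^ 2 ≤ (2 * Lk (k m₀)) ^ 2 := by
      rw [show (2 * Lk (k m₀)) ^ 2 = 4 * Lk (k m₀) ^ 2 by ring]
      exact mul_le_mul_of_nonneg_right (by linarith) (sq_nonneg _)
    rw [h1]; linarith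
  have key : ENNReal.ofReal (∑ p ∈ I, c * Lk (k p.1)) ≤ ENNReal.ofReal (E' * R) := by
    calc ENNReal.ofReal (∑ p ∈ I, c * Lk (k p.1))
        = ∑ p ∈ I, ENNReal.ofReal (c * Lk (k p.1)) :=
          ENNReal.ofReal_sum_of_nonneg fun p _ => (mul_pos hc (hLpos _)).le
      _ ≤ ∑ p ∈ I, μ (B p.1 p.2) := Finset.sum_le_sum fun p hp => hBspend p.1 p.2 (hmemI p hp).1 (hmemI p hp).2
      _ = μ (⋃ p ∈ I, B p.1 p.2) := (measure_biUnion_finset hpd fun p _ => hBmeas p.1 p.2).symm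
      _ ≤ μ (Set.Icc ((1 + a) * τ (k m₀)) s ×ˢ Metric.ball x₀ R) :=
          measure_mono (Set.iUnion₂_subset fun p hp => hBsub p hp)
      _ ≤ ENNReal.ofReal (E * R) := hBud R _ _ hRpos hτ1s hs hτR
      _ ≤ ENNReal.ofReal (E' * R) := ENNReal.ofReal_le_ofReal (mul_le_mul_of_nonneg_right hEE' hRpos.le)
  have hSum : ∑ p ∈ I, c * Lk (k p.1) = ∑ j ∈ Finset.range (m₀ + 1), ((S j).card : ℝ) * (c * Lk (k j)) := by
    rw [hI, Finset.sum_sigma]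
    refine Finset.sum_congr rfl fun j _ => ?_
    show ∑ z ∈ S j, c * Lk (k j) = _
    rw [Finset.sum_const, nsmul_eq_mul]
  -- per-scale spending `≥ C c L / κ₀`
  have hep : ∀ j ∈ Finset.range (m₀ + 1), C * c * L / κ₀ ≤ ((S j).card : ℝ) * (c * Lk (k j)) := by
    intro j hj
    have hj' : j < m₀ + 1 := Finset.mem_range.1 hj
    have h1 := (hS j hj').1
    have h2 : 0 < κ₀ * Lk (k j) := mul_pos hκ₀pos (hLpos _)
    rw [div_le_iff₀ h2] at h1
    rw [div_le_iff₀ hκ₀pos]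
    nlinarith [h1, hc, hLpos (k j)]
  have hSge : ((m₀ : ℝ) + 1) * (C * c * L / κ₀) ≤ ∑ p ∈ I, c * Lk (k p.1) := by
    rw [hSum]
    have h := Finset.sum_le_sum hep
    rw [Finset.sum_const, Finset.card_range, nsmul_eq_mul] at h
    push_cast at h
    linarith
  -- the contradiction
  have hfin : ∑ p ∈ I, c * Lk (k p.1) ≤ E' * R ∨ ∑ p ∈ I, c * Lk (k p.1) ≤ 0 := ENNReal.ofReal_le_ofReal_iff'.1 key
  have hq : 0 < C * c * L / κ₀ := by positivity
  have hgap : E' * R < ((m₀ : ℝ) + 1) * (C * c * L / κ₀) := by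
    have h1 : E' * (ρ + D + 2) * κ₀ ≤ (m₀ : ℝ) * (C * c) := by
      have h2 := hm₀
      rw [div_le_iff₀ (mul_pos hC hc)] at h2
      exact h2
    have h3 : E' * R = (E' * (ρ + D + 2) * κ₀) * (L / κ₀) := by
      rw [hR]; field_simp
    have h4 : ((m₀ : ℝ) + 1) * (C * c * L / κ₀) = ((m₀ : ℝ) * (C * c)) * (L / κ₀) + C * c * L / κ₀ := by ring
    have h5 : 0 < L / κ₀ := div_pos hLpos' hκ₀pos
    rw [h3, h4]
    nlinarith [mul_le_mul_of_nonneg_right h1 h5.le, hq]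
  have hERnn : 0 ≤ E' * R := mul_nonneg hE'0 hRpos.le
  rcases hfin with h | h <;> nlinarith [hSge, hgap, hq]

end NearExtremalTransiencePerFlow.MultiscaleCrowding

end Summit.NavierStokesRegularity.NavierStokesRegularity.Theorems

end
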